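import Literature.NumberTheory.Sieve.CircleMethodMajorArcsProofs
import Literature.NumberTheory.Sieve.LinearEquationsInPrimesTransference
import HarnessLib

/-!
# The `W`-tricked von Mangoldt function on a major arc (Green–Tao 2010, Thm. 7.2 at `s = 1`)

Topic `Literature/NumberTheory/Sieve`. Everything in this file is PROVED (no named facts, no
`sorry`). It is the major-arc half of the exponential-sum estimate

  `sup_α |∑_{n ≤ N} (Λ'_{b,W}(n) − 1) e(nα)| = o(N)`   (uniformly in `b` coprime to `W = ∏_{p ≤ w} p`,
  `w → ∞` slowly),

which is the level-`s = 1` content of Green–Tao, *Linear equations in primes*, Ann. of Math. 171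
(2010), Thm. 7.2 (`‖Λ'_{b,W} − 1‖_{U²[N]} = o(1)`; by the inverse theorem for the `U²[N]`-norm this
is equivalent to the displayed exponential-sum statement, cf. GT2010 §12, first paragraph: "the
case `s = 1` … can be obtained by the classical Hardy–Littlewood method"). Here
`Λ'_{b,W}(n) = (φ(W)/W) Λ'(Wn + b)` is `Literature.NumberTheory.Sieve.vonMangoldtW W b n`.

## The estimate (`norm_sum_vonMangoldtW_sub_one_majorArc_le`)

For `1 ≤ b < W`, `(b, W) = 1`, `q ≥ 1`, `(a, q) = 1`, `X = WN + b ≥ 9`, `qW ≤ (log X / 2)^{A₂}`,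
a Siegel–Walfisz bound `SWBound A₂ C₂` (`BombieriVinogradovFacts.lean`; discharged in the tree by
`Literature.NumberTheory.LFunctions.siegel_walfisz_holds`) and every real `β`:

  `‖∑_{n ≤ N} (Λ'_{b,W}(n) − 1) e(n(a/q + β))‖ ≤ q·Mq·(1 + 2π|β|N) + [q > 1, (q,W) = 1]·(N + 2q)/φ(q) + q²(1 + 2π|β|N)`,

`Mq = 7√X + C₂ 2^{A₂} X/log^{A₂} X + 2√X log X + log(qW) + 2q + 1` (`majorErr`). The argument is
Nathanson's (GTM 164, Lemmas 8.2–8.3, as formalised for `Λ` in `CircleMethodMajorArcsProofs.lean`)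
run for the progression `Wn + b`:

* split `n ≤ N` by `i = n mod q`, so `e(na/q) = ζ^i`, `ζ = e(a/q)` (`sum_Icc_eq_sum_range_sum_filter`);
* on the class `i`, the primes `Wn + b` are the primes `≡ Wi + b (mod qW)`; if `(Wi + b, q) = 1`
  Siegel–Walfisz for the modulus `qW` (uniformly in the length, `abs_chebyshevPsiMod_sub_le_of_SW`)
  gives `∑_{n ≤ t, n ≡ i} Λ'_{b,W}(n) = (φ(W)/φ(qW)) t + O(Mq)` (`abs_partialSum_le`, through
  `abs_Pfun_sub_chebyshevPsiMod_le`: the substitution `m = Wn + b`, the prime `m = b`, and the prime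
  powers `ψ − ϑ ≤ 2√X log X`); if `(Wi + b, q) > 1` the class contains only primes dividing `q`
  (`Pfun_le_log_of_not_coprime`);
* partial summation (`norm_sum_Icc_mul_le` of `CircleMethodMajorArcsProofs`) turns this into
  `‖E_i(β)‖ ≤ Mq (1 + 2π|β|N)` for the twisted class sums of `Λ'_{b,W} − dens_i` (`norm_errSum_le`);
* the main term `∑_i ζ^i (dens_i − 1) V_i(β)`, `V_i(β) = ∑_{n ≤ N, n ≡ i} e(nβ)`: the `V_i` are almost
  equal (`norm_classExpSum_sub_le`, partial summation again, the class counts differing by `≤ 1`),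
  `∑_i ζ^i = 0` for `q > 1`, and the Ramanujan-type sum `∑_{(Wi+b, q) = 1} ζ^i` VANISHES when `q`
  shares a prime with `W` (`sum_pow_filter_coprime_eq_zero` — this is the `W`-trick) and has modulus
  `|μ(q)| ≤ 1` when `(q, W) = 1` (`norm_sum_pow_filter_coprime_le_one`, from the tree's Ramanujan sum
  `sum_pow_coprime_eq_moebius`), where then `dens = q/φ(q)` (`norm_mainTerm_le`).

The minor arcs (Vinogradov) and the assembly into Thm. 7.2 at `s = 1` are in the companion files
`LinearEquationsInPrimesWTrickMinorArc.lean` / `LinearEquationsInPrimesWTrickExpSum.lean`.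

## References

* [GreenTao2010] B. Green, T. Tao, *Linear equations in primes*, Ann. of Math. 171 (2010),
  1753–1850, Thm. 7.2 and §12 (arXiv:math/0606088, pp. 17, 29–30).
* [Nathanson1996] M. B. Nathanson, *Additive Number Theory: The Classical Bases*, GTM 164
  (Springer 1996), §8.2, Lemmas 8.2–8.3; Thm. A.24 (Ramanujan sums).
-/

noncomputable section

open scoped FourierTransform ArithmeticFunction ArithmeticFunction.Moebius
open Finset

namespace Literature.NumberTheory.Sieve

namespace WTrick

open ParityWave0 CircleMethodMajorArcs


/-! ### Residue classes modulo `q` inside `[1, t]` -/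

/-- `cnt q i t = #{n ∈ [1, t] : n % q = i}`, the number of elements of the residue class
`i (mod q)` in `[1, t]`. [folklore] -/
def cnt (q i t : ℕ) : ℕ := ((Icc 1 t).filter (fun n => n % q = i)).card

/-- `cnt q i t = ⌊(t+1)/q⌋ + [i < (t+1) % q] − [i = 0]` for `0 ≤ i < q` (Mathlib's
`Nat.count_modEq_card` on `[0, t]`, minus the element `0` of the class `0`). [folklore] -/
theorem cnt_eq {q i : ℕ} (hq : 0 < q) (hi : i < q) (t : ℕ) :
    (cnt q i t : ℤ) = ((t + 1) / q : ℕ) + (if i < (t + 1) % q then 1 else 0) -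
      (if i = 0 then 1 else 0) := by
  classical
  have hcount : ((range (t + 1)).filter (fun n => n % q = i)).card =
      (t + 1) / q + (if i < (t + 1) % q then 1 else 0) := by
    have h := Nat.count_modEq_card (t + 1) hq i
    rw [Nat.count_eq_card_filter_range, Nat.mod_eq_of_lt hi] at h
    rw [← h]
    congr 1
    refine Finset.filter_congr fun n _ => ?_
    simp only [Nat.ModEq, Nat.mod_eq_of_lt hi]
  have hsplit : ((range (t + 1)).filter (fun n => n % q = i)).card =
      cnt q i t + (if i = 0 then 1 else 0) := by
    rw [cnt, Nat.range_succ_eq_Icc_zero, ← Finset.insert_Icc_add_one_left_eq_Icc (Nat.zero_le t),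
      Finset.filter_insert]
    simp only [Nat.zero_mod, zero_add]
    by_cases h0 : (0 : ℕ) = i
    · rw [if_pos h0, if_pos h0.symm, Finset.card_insert_of_notMem (by simp)]
    · rw [if_neg h0, if_neg (Ne.symm h0), add_zero]
  have := hcount.symm.trans hsplit
  have h : (((t + 1) / q : ℕ) : ℤ) + ((if i < (t + 1) % q then 1 else 0 : ℕ) : ℤ) =
      (cnt q i t : ℤ) + ((if i = 0 then 1 else 0 : ℕ) : ℤ) := by exact_mod_cast this
  simp only [Nat.cast_ite, Nat.cast_one, Nat.cast_zero] at h
  linarith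

/-- Two residue classes modulo `q` have, inside `[1, t]`, cardinalities differing by at most
one. [folklore] -/
theorem abs_cnt_sub_cnt_zero_le_one {q i : ℕ} (hq : 0 < q) (hi : i < q) (t : ℕ) :
    |(cnt q i t : ℝ) - cnt q 0 t| ≤ 1 := by
  have h1 := cnt_eq hq hi t
  have h0 := cnt_eq hq hq t
  have hz : |(cnt q i t : ℤ) - cnt q 0 t| ≤ 1 := by
    by_cases hi0 : i = 0
    · subst hi0; simp
    rw [h1, h0, if_neg hi0, if_pos rfl, abs_le]
    constructor <;> split_ifs <;> omega
  have : ((|(cnt q i t : ℤ) - cnt q 0 t| : ℤ) : ℝ) ≤ 1 := by exact_mod_cast hz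
  simpa [Int.cast_abs] using this

/-- `|cnt q i t − t/q| ≤ 2`. [folklore] -/
theorem abs_cnt_sub_div_le_two {q i : ℕ} (hq : 0 < q) (hi : i < q) (t : ℕ) :
    |(cnt q i t : ℝ) - t / q| ≤ 2 := by
  have h1 := cnt_eq hq hi t
  set d : ℕ := (t + 1) / q with hd
  have hq0 : (0 : ℝ) < q := by exact_mod_cast hq
  have hdle : (q : ℝ) * d ≤ t + 1 := by exact_mod_cast Nat.mul_div_le (t + 1) q
  have hdlt : (t + 1 : ℝ) < q * (d + 1) := by
    have := Nat.lt_mul_div_succ (t + 1) hq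
    exact_mod_cast this
  have hcR : (cnt q i t : ℝ) = d + (if i < (t + 1) % q then 1 else 0) - (if i = 0 then 1 else 0) := by
    exact_mod_cast h1
  have he1 : (0 : ℝ) ≤ (if i < (t + 1) % q then 1 else 0 : ℝ) ∧
      (if i < (t + 1) % q then 1 else 0 : ℝ) ≤ 1 := by split_ifs <;> norm_num
  have he2 : (0 : ℝ) ≤ (if i = 0 then 1 else 0 : ℝ) ∧ (if i = 0 then 1 else 0 : ℝ) ≤ 1 := by
    split_ifs <;> norm_num
  have hdiv1 : (d : ℝ) ≤ (t + 1) / q := by rw [le_div_iff₀ hq0]; linarith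
  have hdiv2 : (t + 1 : ℝ) / q < d + 1 := by rw [div_lt_iff₀ hq0]; linarith
  have hq1 : (1 : ℝ) / q ≤ 1 := by
    rw [div_le_one hq0]; exact_mod_cast hq
  have hq1' : 0 < (1 : ℝ) / q := by positivity
  have hsplit : (t + 1 : ℝ) / q = t / q + 1 / q := by ring
  rw [hcR, abs_le]
  constructor <;> nlinarith [he1.1, he1.2, he2.1, he2.2]

/-- `cnt q i t ≤ t/q + 2`. [folklore] -/
theorem cnt_le {q i : ℕ} (hq : 0 < q) (hi : i < q) (t : ℕ) : (cnt q i t : ℝ) ≤ t / q + 2 := by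
  have := abs_cnt_sub_div_le_two hq hi t
  rw [abs_le] at this
  linarith [this.2]

/-! ### Splitting `[1, N]` into residue classes; the classes carry almost equal exponential sums -/

/-- `∑_{n ≤ N} g(n) = ∑_{i < q} ∑_{n ≤ N, n % q = i} g(n)`. [folklore] -/
theorem sum_Icc_eq_sum_range_sum_filter {q : ℕ} (hq : 0 < q) (g : ℕ → ℂ) (N : ℕ) :
    ∑ n ∈ Icc 1 N, g n = ∑ i ∈ range q, ∑ n ∈ (Icc 1 N).filter (fun n => n % q = i), g n := by
  rw [Finset.sum_fiberwise_of_maps_to (g := fun n => n % q)]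
  intro n _
  exact Finset.mem_range.2 (Nat.mod_lt _ hq)

/-- The linear exponential sum over a residue class, `V_i(β) = ∑_{n ≤ N, n ≡ i (q)} e(nβ)`.
[folklore] -/
def classExpSum (q i N : ℕ) (β : ℝ) : ℂ :=
  ∑ n ∈ (Icc 1 N).filter (fun n => n % q = i), (𝐞 (n * β) : ℂ)

/-- `‖V_i(β)‖ ≤ cnt q i N ≤ N/q + 2`. [folklore] -/
theorem norm_classExpSum_le {q i : ℕ} (hq : 0 < q) (hi : i < q) (N : ℕ) (β : ℝ) :
    ‖classExpSum q i N β‖ ≤ N / q + 2 := by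
  refine (norm_sum_le _ _).trans ?_
  have : ∑ n ∈ (Icc 1 N).filter (fun n => n % q = i), ‖(𝐞 (n * β) : ℂ)‖ = cnt q i N := by
    simp [cnt]
  rw [this]
  exact cnt_le hq hi N

/-- **Residue classes carry almost the same linear exponential sum**: for `0 ≤ i < q`,
`‖V_i(β) − V_0(β)‖ ≤ 1 + 2π|β|N`, by partial summation (the partial sums of
`1_{n ≡ i} − 1_{n ≡ 0}` over `[1, t]` are `cnt q i t − cnt q 0 t ∈ [-1, 1]`). [folklore] -/
theorem norm_classExpSum_sub_le {q i : ℕ} (hq : 0 < q) (hi : i < q) (N : ℕ) (β : ℝ) :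
    ‖classExpSum q i N β - classExpSum q 0 N β‖ ≤ 1 + 2 * Real.pi * |β| * N := by
  classical
  set c : ℕ → ℂ := fun n => (if n % q = i then 1 else 0) - (if n % q = 0 then 1 else 0) with hc
  have hrepr : classExpSum q i N β - classExpSum q 0 N β =
      ∑ n ∈ Icc 1 N, c n * (𝐞 (n * β) : ℂ) := by
    simp only [classExpSum, Finset.sum_filter, hc, sub_mul, Finset.sum_sub_distrib, ite_mul,
      one_mul, zero_mul]
  rw [hrepr]
  have hM : ∀ n ≤ N, ‖∑ k ∈ Icc 1 n, c k‖ ≤ 1 := by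
    intro n _
    have : ∑ k ∈ Icc 1 n, c k = (cnt q i n : ℂ) - (cnt q 0 n : ℂ) := by
      simp only [hc, Finset.sum_sub_distrib, Finset.sum_boole, cnt]
    rw [this]
    have h := abs_cnt_sub_cnt_zero_le_one hq hi n
    have : ((cnt q i n : ℂ) - (cnt q 0 n : ℂ)) = ((cnt q i n - cnt q 0 n : ℝ) : ℂ) := by
      push_cast; ring
    rw [this, Complex.norm_real, Real.norm_eq_abs]
    exact h
  have hf : ∀ n : ℕ, ‖(𝐞 ((n : ℕ) * β) : ℂ)‖ ≤ 1 := fun n => (Circle.norm_coe _).le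
  have hδ : ∀ n : ℕ, ‖(𝐞 (((n + 1 : ℕ) : ℝ) * β) : ℂ) - 𝐞 ((n : ℝ) * β)‖ ≤ 2 * Real.pi * |β| := by
    intro n
    refine (norm_fourierChar_sub_fourierChar_le _ _).trans ?_
    rw [show ((n + 1 : ℕ) : ℝ) * β - (n : ℝ) * β = β by push_cast; ring]
  have := norm_sum_Icc_mul_le c (fun n => (𝐞 ((n : ℝ) * β) : ℂ)) N hM hf hδ
  simpa [mul_comm, mul_left_comm, mul_assoc] using this

/-! ### A Ramanujan-type sum over a shifted progression -/

/-- `ζ^(n % q) = ζ^n` when `ζ^q = 1`. [folklore] -/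
theorem pow_mod_eq {ζ : ℂ} {q : ℕ} (h : ζ ^ q = 1) (n : ℕ) : ζ ^ (n % q) = ζ ^ n :=
  (pow_eq_pow_mod n h).symm

/-- **The `W`-trick kills the Ramanujan sum at moduli sharing a prime with `W`.** If `ζ` is a
primitive `q`-th root of unity and the prime `p` divides both `q` and `W`, then
`∑_{i < q, (W i + b, q) = 1} ζ^i = 0`: the summation condition is invariant under
`i ↦ i + q/p (mod q)` (as `W · q/p ≡ 0 (mod q)`), while `ζ^{q/p} ≠ 1`. [folklore] -/
theorem sum_pow_filter_coprime_eq_zero {q W b p : ℕ} (hq : 0 < q) {ζ : ℂ}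
    (hζ : IsPrimitiveRoot ζ q) (hp : p.Prime) (hpq : p ∣ q) (hpW : p ∣ W) :
    ∑ i ∈ (range q).filter (fun i => (W * i + b).Coprime q), ζ ^ i = 0 := by
  classical
  haveI : NeZero q := ⟨hq.ne'⟩
  obtain ⟨s, hs⟩ := hpq
  obtain ⟨v, hv⟩ := hpW
  have hs0 : 0 < s := Nat.pos_of_ne_zero fun h => by simp [h] at hs; omega
  have hsq : s < q := by
    rw [hs]; exact lt_mul_left hs0 hp.one_lt
  have hζq : ζ ^ q = 1 := hζ.pow_eq_one
  -- the sum as a sum over `ZMod q`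
  set g : ℕ → ℂ := fun i => if (W * i + b).Coprime q then ζ ^ i else 0 with hg
  have hS : ∑ i ∈ (range q).filter (fun i => (W * i + b).Coprime q), ζ ^ i =
      ∑ x : ZMod q, g x.val := by
    rw [Finset.sum_filter]
    have : ∑ x : ZMod q, g x.val = ∑ i ∈ range q, g i := by
      have h := Fin.sum_univ_eq_sum_range g q
      rw [← h]
      cases q with
      | zero => exact absurd hq (lt_irrefl 0)
      | succ q => rfl
    rw [this]
  -- invariance of `g ∘ val` under the shift by `s`
  have hshift : ∀ x : ZMod q, g (x + (s : ZMod q)).val = ζ ^ s * g x.val := by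
    intro x
    have hval : (x + (s : ZMod q)).val ≡ x.val + s [MOD q] := by
      have h1 : (((x + (s : ZMod q)).val : ℕ) : ZMod q) = ((x.val + s : ℕ) : ZMod q) := by
        simp [ZMod.natCast_val, ZMod.cast_id]
      exact (ZMod.natCast_eq_natCast_iff _ _ _).1 h1
    have hcong : W * (x + (s : ZMod q)).val + b ≡ W * x.val + b [MOD q] := by
      have hWs : W * s = q * v := by rw [hv, hs]; ring
      have h2 : W * (x.val + s) + b = W * x.val + b + q * v := by rw [← hWs]; ring
      have h3 : W * (x.val + s) + b ≡ W * x.val + b [MOD q] := by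
        rw [h2, Nat.ModEq]; simp
      exact ((hval.mul_left W).add_right b).trans h3
    have hcop : (W * (x + (s : ZMod q)).val + b).Coprime q ↔ (W * x.val + b).Coprime q := by
      unfold Nat.Coprime
      rw [hcong.gcd_eq]
    have hpow : ζ ^ (x + (s : ZMod q)).val = ζ ^ s * ζ ^ x.val := by
      rw [← pow_mod_eq hζq (x + (s : ZMod q)).val, hval, pow_mod_eq hζq, pow_add, mul_comm]
    simp only [hg]
    rw [hpow]
    by_cases hc : (W * x.val + b).Coprime q
    · rw [if_pos (hcop.2 hc), if_pos hc]
    · rw [if_neg (fun h => hc (hcop.1 h)), if_neg hc, mul_zero]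
  have hsum : ∑ x : ZMod q, g x.val = ζ ^ s * ∑ x : ZMod q, g x.val := by
    rw [Finset.mul_sum]
    rw [← Equiv.sum_comp (Equiv.addRight (s : ZMod q)) (fun x => g x.val)]
    exact Finset.sum_congr rfl fun x _ => hshift x
  have hne : ζ ^ s ≠ 1 := hζ.pow_ne_one_of_pos_of_lt hs0.ne' hsq
  rw [hS]
  have : (1 - ζ ^ s) * ∑ x : ZMod q, g x.val = 0 := by
    rw [sub_mul, one_mul, ← hsum, sub_self]
  rcases mul_eq_zero.1 this with h | h
  · exact absurd (sub_eq_zero.1 h).symm hne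
  · exact h

/-- **Ramanujan's sum over a shifted progression, coprime modulus**: if `ζ` is a primitive
`q`-th root of unity and `(q, W) = 1`, then `‖∑_{i < q, (W i + b, q) = 1} ζ^i‖ ≤ 1`; indeed the
sum is `ξ^{-b} c_q(1) = ξ^{-b} μ(q)` for `ξ = ζ^{W⁻¹ mod q}` (substitute `j = W i + b`).
[cite: Nathanson1996, Thm A.24] -/
theorem norm_sum_pow_filter_coprime_le_one {q W b : ℕ} (hq : 0 < q) {ζ : ℂ}
    (hζ : IsPrimitiveRoot ζ q) (hqW : q.Coprime W) :
    ‖∑ i ∈ (range q).filter (fun i => (W * i + b).Coprime q), ζ ^ i‖ ≤ 1 := by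
  classical
  rcases eq_or_lt_of_le (Nat.one_le_iff_ne_zero.2 hq.ne') with h1 | h1
  · -- `q = 1`
    subst h1
    have : (range 1).filter (fun i => (W * i + b).Coprime 1) = {0} := by
      ext i; simp
    rw [this]; simp
  -- `q > 1`: pick `u` with `W u ≡ 1 (mod q)`
  obtain ⟨u, -, hu⟩ := Nat.exists_mul_mod_eq_one_of_coprime hqW.symm h1
  have hζq : ζ ^ q = 1 := hζ.pow_eq_one
  have hζ0 : ζ ≠ 0 := hζ.ne_zero hq.ne'
  set ξ : ℂ := ζ ^ u with hξ
  have hWu1 : W * u ≡ 1 [MOD q] := by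
    rw [Nat.ModEq, hu, Nat.one_mod_eq_one.2 h1.ne']
  have huq : u.Coprime q := by
    have : (W * u).Coprime q := by
      rw [Nat.Coprime, hWu1.gcd_eq, Nat.gcd_one_left]
    exact Nat.Coprime.coprime_mul_left this
  have hξprim : IsPrimitiveRoot ξ q := hζ.pow_of_coprime u huq
  have hξW : ξ ^ W = ζ := by
    rw [hξ, ← pow_mul, ← pow_mod_eq hζq, mul_comm, hu, pow_one]
  have hξ0 : ξ ≠ 0 := pow_ne_zero _ hζ0
  -- `ζ^i = ξ^{W i + b} / ξ^b`
  have hterm : ∀ i, ζ ^ i = ξ ^ ((W * i + b) % q) * (ξ ^ b)⁻¹ := by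
    intro i
    rw [pow_mod_eq hξprim.pow_eq_one, pow_add, pow_mul, hξW, mul_assoc,
      mul_inv_cancel₀ (pow_ne_zero _ hξ0), mul_one]
  have hS : ∑ i ∈ (range q).filter (fun i => (W * i + b).Coprime q), ζ ^ i =
      (∑ i ∈ (range q).filter (fun i => (W * i + b).Coprime q), ξ ^ ((W * i + b) % q)) *
        (ξ ^ b)⁻¹ := by
    rw [Finset.sum_mul]
    exact Finset.sum_congr rfl fun i _ => hterm i
  -- reindex `i ↦ (W i + b) % q`, a bijection onto the reduced residues
  have hbij : ∑ i ∈ (range q).filter (fun i => (W * i + b).Coprime q), ξ ^ ((W * i + b) % q) =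
      ∑ j ∈ (range q).filter (fun j => j.Coprime q), ξ ^ j := by
    refine Finset.sum_bij (fun i _ => (W * i + b) % q) ?_ ?_ ?_ (fun _ _ => rfl)
    · intro i hi
      rw [Finset.mem_filter] at hi ⊢
      exact ⟨Finset.mem_range.2 (Nat.mod_lt _ hq), (ZMod.coprime_mod_iff_coprime _ _).2 hi.2⟩
    · intro i hi i' hi' h
      rw [Finset.mem_filter, Finset.mem_range] at hi hi'
      have e1 : W * i + b ≡ W * i' + b [MOD q] := h
      have h2 : W * i ≡ W * i' [MOD q] := Nat.ModEq.add_right_cancel' b e1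
      have h3 : u * (W * i) ≡ u * (W * i') [MOD q] := h2.mul_left u
      have h4 : ∀ k, u * (W * k) ≡ k [MOD q] := by
        intro k
        have : u * (W * k) = (W * u) * k := by ring
        rw [this]
        simpa using hWu1.mul_right k
      have h6 : i ≡ i' [MOD q] := ((h4 i).symm.trans h3).trans (h4 i')
      rw [Nat.ModEq, Nat.mod_eq_of_lt hi.1, Nat.mod_eq_of_lt hi'.1] at h6
      exact h6
    · intro j hj
      rw [Finset.mem_filter, Finset.mem_range] at hj
      refine ⟨(u * (j + (q - b % q))) % q, ?_, ?_⟩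
      · rw [Finset.mem_filter, Finset.mem_range]
        refine ⟨Nat.mod_lt _ hq, ?_⟩
        have hc : W * (u * (j + (q - b % q)) % q) + b ≡ j [MOD q] := by
          have e1 : W * (u * (j + (q - b % q)) % q) + b ≡ W * (u * (j + (q - b % q))) + b [MOD q] :=
            ((Nat.mod_modEq _ q).mul_left W).add_right b
          have e2 : W * (u * (j + (q - b % q))) + b = (W * u) * (j + (q - b % q)) + b := by ring
          have e3 : (W * u) * (j + (q - b % q)) + b ≡ 1 * (j + (q - b % q)) + b [MOD q] := by
            exact (hWu1.mul_right _).add_right b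
          have e4 : 1 * (j + (q - b % q)) + b ≡ j [MOD q] := by
            rw [one_mul]
            have hbq : b % q ≤ q := (Nat.mod_lt b hq).le
            have : j + (q - b % q) + b = j + (q + (b - b % q)) := by
              have := Nat.mod_le b q
              omega
            rw [this, Nat.ModEq]
            have hdvd : q ∣ q + (b - b % q) :=
              dvd_add dvd_rfl (Nat.dvd_sub_mod b)
            obtain ⟨k, hk⟩ := hdvd
            rw [hk]; simp
          exact e1.trans (e2 ▸ e3.trans e4)
        rw [Nat.Coprime, ← hc.gcd_eq] at hj
        exact hj.2
      · have hc : W * (u * (j + (q - b % q)) % q) + b ≡ j [MOD q] := by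
          have e1 : W * (u * (j + (q - b % q)) % q) + b ≡ W * (u * (j + (q - b % q))) + b [MOD q] :=
            ((Nat.mod_modEq _ q).mul_left W).add_right b
          have e2 : W * (u * (j + (q - b % q))) + b = (W * u) * (j + (q - b % q)) + b := by ring
          have e3 : (W * u) * (j + (q - b % q)) + b ≡ 1 * (j + (q - b % q)) + b [MOD q] := by
            exact (hWu1.mul_right _).add_right b
          have e4 : 1 * (j + (q - b % q)) + b ≡ j [MOD q] := by
            rw [one_mul]
            have : j + (q - b % q) + b = j + (q + (b - b % q)) := by
              have := Nat.mod_le b q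
              have := (Nat.mod_lt b hq).le
              omega
            rw [this, Nat.ModEq]
            obtain ⟨k, hk⟩ : q ∣ q + (b - b % q) := dvd_add dvd_rfl (Nat.dvd_sub_mod b)
            rw [hk]; simp
          exact e1.trans (e2 ▸ e3.trans e4)
        have := hc
        rw [Nat.ModEq, Nat.mod_eq_of_lt hj.1] at this
        exact this
  rw [hS, hbij, sum_pow_coprime_eq_moebius hq hξprim, norm_mul, norm_inv, norm_pow, hξ, norm_pow,
    hζ.norm'_eq_one hq.ne', one_pow, one_pow, inv_one, mul_one, Complex.norm_intCast]
  exact_mod_cast ArithmeticFunction.abs_moebius_le_one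



/-! ### The `W`-tricked primes in a residue class modulo `q` -/

/-- `Pfun W b q i t = ∑_{n ≤ t, n % q = i} Λ'(W n + b)`: the logarithmically weighted count of
the primes `W n + b`, `1 ≤ n ≤ t`, `n ≡ i (mod q)`. [folklore] -/
def Pfun (W b q i t : ℕ) : ℝ :=
  ∑ n ∈ (Icc 1 t).filter (fun n => n % q = i), vonMangoldtPrime (W * n + b)

/-- `Pfun ≥ 0`. [folklore] -/
theorem Pfun_nonneg (W b q i t : ℕ) : 0 ≤ Pfun W b q i t :=
  Finset.sum_nonneg fun _ _ => (vonMangoldtPrime_le_vonMangoldt _).1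

/-- `Pfun` as a sum of `log (W n + b)` over the `n` with `W n + b` prime. [folklore] -/
theorem Pfun_eq_sum_filter (W b q i t : ℕ) :
    Pfun W b q i t = ∑ n ∈ ((Icc 1 t).filter (fun n => n % q = i)).filter
      (fun n => (W * n + b).Prime), Real.log (W * n + b : ℕ) := by
  rw [Pfun]
  symm
  rw [Finset.sum_filter]
  refine Finset.sum_congr rfl fun n _ => ?_
  simp only [vonMangoldtPrime]

/-- **Classes not coprime to `q` carry almost no primes**: if `(W i + b, q) > 1` then every prime
`W n + b` with `n ≡ i (mod q)` divides `q`, so `Pfun W b q i t ≤ ∑_{p ∣ q} log p ≤ log q`.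
[folklore] -/
theorem Pfun_le_log_of_not_coprime {W b q i : ℕ} (hq : 0 < q) (hW : 0 < W) (hi : i < q)
    (hnc : ¬ (W * i + b).Coprime q) (t : ℕ) : Pfun W b q i t ≤ Real.log q := by
  classical
  rw [Pfun_eq_sum_filter]
  set S := ((Icc 1 t).filter (fun n => n % q = i)).filter (fun n => (W * n + b).Prime) with hS
  -- every prime `W n + b`, `n ∈ S`, divides `q`
  have hmem : ∀ n ∈ S, (W * n + b) ∈ q.primeFactors := by
    intro n hn
    simp only [hS, Finset.mem_filter, Finset.mem_Icc] at hn
    obtain ⟨⟨-, hnq⟩, hp⟩ := hn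
    have hcong : W * n + b ≡ W * i + b [MOD q] := by
      have : n ≡ i [MOD q] := by rw [Nat.ModEq, hnq, Nat.mod_eq_of_lt hi]
      exact (this.mul_left W).add_right b
    have hnc' : ¬ (W * n + b).Coprime q := by
      rwa [Nat.Coprime, hcong.gcd_eq]
    have hdvd : (W * n + b) ∣ q := by
      rcases (Nat.coprime_or_dvd_of_prime hp q) with h | h
      · exact absurd h hnc'
      · exact h
    exact Nat.mem_primeFactors.2 ⟨hp, hdvd, hq.ne'⟩
  have hinj : Set.InjOn (fun n => W * n + b) (S : Set ℕ) := by
    intro n _ n' _ h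
    have : W * n = W * n' := by simpa using h
    exact Nat.eq_of_mul_eq_mul_left hW this
  calc ∑ n ∈ S, Real.log (W * n + b : ℕ)
      = ∑ p ∈ S.image (fun n => W * n + b), Real.log (p : ℕ) := by
        rw [Finset.sum_image hinj]
    _ ≤ ∑ p ∈ q.primeFactors, Real.log (p : ℕ) := by
        refine Finset.sum_le_sum_of_subset_of_nonneg ?_ fun p hp _ =>
          Real.log_nonneg (by exact_mod_cast (Nat.prime_of_mem_primeFactors hp).one_lt.le)
        intro p hp
        obtain ⟨n, hn, rfl⟩ := Finset.mem_image.1 hp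
        exact hmem n hn
    _ ≤ Real.log q := sum_primeFactors_log_le hq.ne'

/-- **The prime count of a coprime class, against `ψ(x; qW, W i + b)`.** For `1 ≤ b < W` and
`0 ≤ i < q`, with `X = W t + b`:
`|Pfun W b q i t − ψ(X; qW, W i + b)| ≤ 2 √X log X + log W`.
Indeed `ψ(X; qW, Wi+b)` counts, with weight `Λ`, the `m ≤ X`, `m ≡ W i + b (mod qW)`; the primes
among them exceeding `b` are exactly the `W n + b`, `1 ≤ n ≤ t`, `n ≡ i (mod q)` (substitute
`m = W n + b`), the only other possible prime is `m = b`, and the prime powers contribute at most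
`ψ(X) − ϑ(X) ≤ 2√X log X` (Mathlib's `Chebyshev.psi_sub_theta_le`). [folklore] -/
theorem abs_Pfun_sub_chebyshevPsiMod_le {W b q i : ℕ} (hW : 0 < W) (hb : b < W)
    (hb1 : 1 ≤ b) (hi : i < q) (t : ℕ) :
    |Pfun W b q i t -
        chebyshevPsiMod (q * W) ((W * i + b : ℕ) : ZMod (q * W)) ((W * t + b : ℕ) : ℝ)| ≤
      2 * Real.sqrt ((W * t + b : ℕ) : ℝ) * Real.log ((W * t + b : ℕ) : ℝ) + Real.log W := by
  classical
  set X : ℕ := W * t + b with hX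
  set L : ℕ := q * W with hL
  set c : ZMod L := ((W * i + b : ℕ) : ZMod L) with hc
  -- `ψ(X; L, c)` as a sum over `(0, X]`, then over the class of `c`
  have hpsi : chebyshevPsiMod L c (X : ℝ) =
      ∑ m ∈ (Ioc 0 X).filter (fun m : ℕ => (m : ZMod L) = c), (Λ m : ℝ) := by
    rw [chebyshevPsiMod, Nat.floor_natCast, Finset.range_eq_Ico,
      ← Finset.insert_Ico_add_one_left_eq_Ico (Nat.succ_pos _), Finset.sum_insert (by simp)]
    simp only [ArithmeticFunction.vonMangoldt.residueClass_apply_zero, zero_add]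
    rw [Finset.sum_filter]
    refine Finset.sum_congr rfl fun m _ => ?_
    simp only [ArithmeticFunction.vonMangoldt.residueClass, Set.indicator_apply, Set.mem_setOf_eq]
  -- split into primes and non-primes
  set T : Finset ℕ := (Ioc 0 X).filter (fun m : ℕ => (m : ZMod L) = c) with hT
  have hsplit := Finset.sum_filter_add_sum_filter_not T Nat.Prime (fun m => (Λ m : ℝ))
  -- the non-prime part lies in `[0, ψ X − θ X]`
  have hnp0 : 0 ≤ ∑ m ∈ T.filter (fun m => ¬ m.Prime), (Λ m : ℝ) :=
    Finset.sum_nonneg fun m _ => ArithmeticFunction.vonMangoldt_nonneg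
  have hnp1 : ∑ m ∈ T.filter (fun m => ¬ m.Prime), (Λ m : ℝ) ≤
      Chebyshev.psi X - Chebyshev.theta X := by
    rw [Chebyshev.psi_sub_theta_eq_sum_not_prime, Nat.floor_natCast]
    refine Finset.sum_le_sum_of_subset_of_nonneg ?_ fun m _ _ =>
      ArithmeticFunction.vonMangoldt_nonneg
    intro m hm
    simp only [hT, Finset.mem_filter] at hm ⊢
    exact ⟨hm.1.1, hm.2⟩
  have hpt : Chebyshev.psi X - Chebyshev.theta X ≤ 2 * Real.sqrt X * Real.log X := by
    refine Chebyshev.psi_sub_theta_le ?_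
    have : 1 ≤ X := by rw [hX]; omega
    exact_mod_cast this
  -- the prime part: `m = b` (possibly) and the `W n + b`, `n ∈ [1, t]`, `n ≡ i`
  have hprime : ∑ m ∈ T.filter Nat.Prime, (Λ m : ℝ) =
      ∑ m ∈ (T.filter Nat.Prime).filter (fun m => b < m), Real.log (m : ℕ) +
        ∑ m ∈ (T.filter Nat.Prime).filter (fun m => ¬ b < m), Real.log (m : ℕ) := by
    rw [← Finset.sum_filter_add_sum_filter_not (T.filter Nat.Prime) (fun m => b < m)]
    congr 1 <;> refine Finset.sum_congr rfl fun m hm => ?_ <;>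
      rw [ArithmeticFunction.vonMangoldt_apply_prime (Finset.mem_filter.1 (Finset.mem_filter.1 hm).1).2]
  -- the small primes in the class: only `m = b`
  have hsmall0 : 0 ≤ ∑ m ∈ (T.filter Nat.Prime).filter (fun m => ¬ b < m), Real.log (m : ℕ) :=
    Finset.sum_nonneg fun m hm => Real.log_nonneg (by
      have := (Finset.mem_filter.1 (Finset.mem_filter.1 hm).1).2
      exact_mod_cast this.one_lt.le)
  have hsmall1 : ∑ m ∈ (T.filter Nat.Prime).filter (fun m => ¬ b < m), Real.log (m : ℕ) ≤
      Real.log W := by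
    have hsub : (T.filter Nat.Prime).filter (fun m => ¬ b < m) ⊆ {b} := by
      intro m hm
      simp only [hT, Finset.mem_filter, Finset.mem_Ioc] at hm
      obtain ⟨⟨⟨⟨hm0, -⟩, hmc⟩, -⟩, hmb⟩ := hm
      rw [Finset.mem_singleton]
      have h1 : m ≡ W * i + b [MOD L] := (ZMod.natCast_eq_natCast_iff _ _ _).1 hmc
      have h2 : m ≡ W * i + b [MOD W] := by rw [hL] at h1; exact h1.of_mul_left q
      have h3 : W * i + b ≡ b [MOD W] := by
        rw [Nat.ModEq, Nat.mul_add_mod]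
      have h4 := h2.trans h3
      rw [Nat.ModEq, Nat.mod_eq_of_lt (by omega : m < W), Nat.mod_eq_of_lt hb] at h4
      exact h4
    calc ∑ m ∈ (T.filter Nat.Prime).filter (fun m => ¬ b < m), Real.log (m : ℕ)
        ≤ ∑ m ∈ ({b} : Finset ℕ), Real.log (m : ℕ) :=
          Finset.sum_le_sum_of_subset_of_nonneg hsub fun m hm _ => by
            rw [Finset.mem_singleton] at hm; subst hm
            exact Real.log_nonneg (by exact_mod_cast hb1)
      _ = Real.log b := by simp
      _ ≤ Real.log W := Real.log_le_log (by exact_mod_cast hb1) (by exact_mod_cast hb.le)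
  -- the large primes in the class are the `W n + b`
  have hlarge : ∑ m ∈ (T.filter Nat.Prime).filter (fun m => b < m), Real.log (m : ℕ) =
      Pfun W b q i t := by
    rw [Pfun_eq_sum_filter]
    symm
    refine Finset.sum_nbij' (fun n => W * n + b) (fun m => m / W) ?_ ?_ ?_ ?_ ?_
    · intro n hn
      simp only [Finset.mem_filter, Finset.mem_Icc] at hn
      obtain ⟨⟨⟨hn1, hnt⟩, hnq⟩, hp⟩ := hn
      simp only [hT, Finset.mem_filter, Finset.mem_Ioc]
      refine ⟨⟨⟨⟨by positivity, ?_⟩, ?_⟩, hp⟩, ?_⟩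
      · rw [hX]; exact Nat.add_le_add_right (Nat.mul_le_mul_left W hnt) b
      · rw [hc, ZMod.natCast_eq_natCast_iff, hL]
        have h1 : n ≡ i [MOD q] := by rw [Nat.ModEq, hnq, Nat.mod_eq_of_lt hi]
        have h2 : W * n ≡ W * i [MOD W * q] := Nat.ModEq.mul_left' W h1
        rw [mul_comm W q] at h2
        exact h2.add_right b
      · have : 0 < W * n := Nat.mul_pos hW (by omega)
        omega
    · intro m hm
      simp only [hT, Finset.mem_filter, Finset.mem_Ioc] at hm
      obtain ⟨⟨⟨⟨-, hmX⟩, hmc⟩, hp⟩, hbm⟩ := hm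
      have h1 : m ≡ W * i + b [MOD L] := (ZMod.natCast_eq_natCast_iff _ _ _).1 hmc
      have hmW : m % W = b := by
        have h2 : m ≡ W * i + b [MOD W] := by rw [hL] at h1; exact h1.of_mul_left q
        have h3 : W * i + b ≡ b [MOD W] := by rw [Nat.ModEq, Nat.mul_add_mod]
        have h4 := h2.trans h3
        rwa [Nat.ModEq, Nat.mod_eq_of_lt hb] at h4
      have hdm : W * (m / W) + b = m := by
        conv_rhs => rw [← Nat.div_add_mod m W]
        rw [hmW]
      simp only [Finset.mem_filter, Finset.mem_Icc]
      refine ⟨⟨⟨?_, ?_⟩, ?_⟩, by rwa [hdm]⟩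
      · refine Nat.one_le_iff_ne_zero.2 fun h0 => ?_
        rw [h0, mul_zero, zero_add] at hdm
        omega
      · have : W * (m / W) ≤ W * t := by rw [hX] at hmX; omega
        exact Nat.le_of_mul_le_mul_left this hW
      · have h5 : W * (m / W) + b ≡ W * i + b [MOD q * W] := by rw [hdm, ← hL]; exact h1
        have h6 : W * (m / W) ≡ W * i [MOD W * q] := by
          rw [mul_comm W q]; exact Nat.ModEq.add_right_cancel' b h5
        have h7 : m / W ≡ i [MOD q] := Nat.ModEq.mul_left_cancel' hW.ne' h6
        rw [Nat.ModEq, Nat.mod_eq_of_lt hi] at h7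
        exact h7
    · intro n _
      show (W * n + b) / W = n
      rw [Nat.mul_add_div hW, Nat.div_eq_of_lt hb, add_zero]
    · intro m hm
      simp only [hT, Finset.mem_filter, Finset.mem_Ioc] at hm
      obtain ⟨⟨⟨⟨-, -⟩, hmc⟩, -⟩, -⟩ := hm
      have h1 : m ≡ W * i + b [MOD L] := (ZMod.natCast_eq_natCast_iff _ _ _).1 hmc
      have h2 : m ≡ W * i + b [MOD W] := by rw [hL] at h1; exact h1.of_mul_left q
      have h3 : W * i + b ≡ b [MOD W] := by rw [Nat.ModEq, Nat.mul_add_mod]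
      have h4 := h2.trans h3
      rw [Nat.ModEq, Nat.mod_eq_of_lt hb] at h4
      show W * (m / W) + b = m
      conv_rhs => rw [← Nat.div_add_mod m W]
      rw [h4]
    · intro n _
      rfl
  -- assemble
  have hkey : chebyshevPsiMod L c (X : ℝ) = Pfun W b q i t +
      (∑ m ∈ (T.filter Nat.Prime).filter (fun m => ¬ b < m), Real.log (m : ℕ) +
        ∑ m ∈ T.filter (fun m => ¬ m.Prime), (Λ m : ℝ)) := by
    rw [hpsi, ← hsplit, hprime, hlarge]; ring
  rw [hkey, abs_le]
  constructor <;> nlinarith [hnp0, hnp1, hpt, hsmall0, hsmall1]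

/-- The density of `Λ'_{b,W}` on the class `i (mod q)`, normalised by `q`:
`dens W b q i = q φ(W)/φ(qW)` if `(W i + b, q) = 1` and `0` otherwise (so that
`∑_{n ≤ t, n ≡ i} Λ'_{b,W}(n) ≈ dens · #{n ≤ t : n ≡ i} ≈ (φ(W)/φ(qW)) t`). [folklore] -/
def dens (W b q i : ℕ) : ℝ :=
  if (W * i + b).Coprime q then (q : ℝ) * (Nat.totient W : ℝ) / (Nat.totient (q * W) : ℝ) else 0

/-- `φ(W) ≤ φ(qW)` for `q ≥ 1`. [folklore] -/
theorem totient_le_totient_mul {q W : ℕ} (hq : 0 < q) (hW : 0 < W) :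
    (Nat.totient W : ℝ) ≤ Nat.totient (q * W) := by
  exact_mod_cast Nat.le_of_dvd (Nat.totient_pos.2 (Nat.mul_pos hq hW))
    (Nat.totient_dvd_of_dvd (dvd_mul_left W q))

/-- `0 ≤ dens ≤ q`. [folklore] -/
theorem dens_mem {W b q i : ℕ} (hq : 0 < q) (hW : 0 < W) :
    0 ≤ dens W b q i ∧ dens W b q i ≤ q := by
  unfold dens
  have hφ : (0 : ℝ) < Nat.totient (q * W) := by exact_mod_cast Nat.totient_pos.2 (Nat.mul_pos hq hW)
  have hle := totient_le_totient_mul hq hW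
  split_ifs
  · refine ⟨by positivity, ?_⟩
    rw [div_le_iff₀ hφ]
    exact mul_le_mul_of_nonneg_left hle (Nat.cast_nonneg q)
  · exact ⟨le_rfl, Nat.cast_nonneg q⟩

/-- `|dens − 1| ≤ q`. [folklore] -/
theorem abs_dens_sub_one_le {W b q i : ℕ} (hq : 0 < q) (hW : 0 < W) :
    |dens W b q i - 1| ≤ q := by
  have h := dens_mem (b := b) (i := i) hq hW
  have hq1 : (1 : ℝ) ≤ q := by exact_mod_cast hq
  rw [abs_le]; constructor <;> linarith [h.1, h.2]

/-- The major-arc error size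
`Mq = 7√X + C₂ 2^{A₂} X/(log X)^{A₂} + 2√X log X + log(qW) + 2q + 1`. [folklore] -/
def majorErr (A₂ C₂ X : ℝ) (q W : ℕ) : ℝ :=
  7 * Real.sqrt X + C₂ * 2 ^ A₂ * X / Real.log X ^ A₂ + 2 * Real.sqrt X * Real.log X +
    Real.log ((q * W : ℕ) : ℝ) + 2 * q + 1

/-- **Partial sums of `Λ'_{b,W} − dens` along a residue class (Siegel–Walfisz).** For
`1 ≤ b < W`, `(b, W) = 1`, `0 ≤ i < q`, `X = W N + b ≥ 9`, `qW ≤ (log X / 2)^{A₂}` and `t ≤ N`: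
`|(φ(W)/W) Pfun W b q i t − dens · cnt q i t| ≤ Mq`, given the Siegel–Walfisz bound in the
packaged form `SWBound A₂ C₂` (applied with modulus `qW` through
`abs_chebyshevPsiMod_sub_le_of_SW`, uniform in `W t + b ≤ X`). [folklore] -/
theorem abs_partialSum_le {A₂ C₂ : ℝ} (hA₂ : 0 < A₂) (hC₂ : 0 ≤ C₂) (hSW : SWBound A₂ C₂)
    {W b q N : ℕ} (hW : 0 < W) (hb : b < W) (hb1 : 1 ≤ b) (hbW : b.Coprime W) (hq : 0 < q)
    {i : ℕ} (hi : i < q) (hX9 : (9 : ℝ) ≤ ((W * N + b : ℕ) : ℝ))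
    (hqW : ((q * W : ℕ) : ℝ) ≤ (Real.log ((W * N + b : ℕ) : ℝ) / 2) ^ A₂) {t : ℕ} (ht : t ≤ N) :
    |(Nat.totient W : ℝ) / W * Pfun W b q i t - dens W b q i * cnt q i t| ≤
      majorErr A₂ C₂ ((W * N + b : ℕ) : ℝ) q W := by
  set X : ℝ := ((W * N + b : ℕ) : ℝ) with hXdef
  have hW0 : (0 : ℝ) < W := by exact_mod_cast hW
  have hq0 : (0 : ℝ) < q := by exact_mod_cast hq
  have hφW0 : (0 : ℝ) < Nat.totient W := by exact_mod_cast Nat.totient_pos.2 hW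
  have hφL0 : (0 : ℝ) < Nat.totient (q * W) := by
    exact_mod_cast Nat.totient_pos.2 (Nat.mul_pos hq hW)
  have hφWle : (Nat.totient W : ℝ) ≤ W := by exact_mod_cast Nat.totient_le W
  have hρ : (Nat.totient W : ℝ) / W ≤ 1 := by rwa [div_le_one hW0]
  have hρ0 : 0 ≤ (Nat.totient W : ℝ) / W := by positivity
  have hX1 : (1 : ℝ) ≤ X := by linarith
  have hX0 : (0 : ℝ) < X := by linarith
  have hLX : 0 ≤ Real.log X := Real.log_nonneg hX1
  have hsX : 0 ≤ Real.sqrt X := Real.sqrt_nonneg X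
  have hlogqW : 0 ≤ Real.log ((q * W : ℕ) : ℝ) :=
    Real.log_nonneg (by exact_mod_cast Nat.mul_pos hq hW)
  have hT1 : 0 ≤ 7 * Real.sqrt X := by positivity
  have hT2 : 0 ≤ C₂ * 2 ^ A₂ * X / Real.log X ^ A₂ := by positivity
  have hT3 : 0 ≤ 2 * Real.sqrt X * Real.log X := by positivity
  by_cases hcop : (W * i + b).Coprime q
  · -- coprime class: Siegel–Walfisz
    have hdens : dens W b q i = (q : ℝ) * (Nat.totient W : ℝ) / (Nat.totient (q * W) : ℝ) := by
      simp [dens, hcop]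
    have hcopL : (W * i + b).Coprime (q * W) := by
      refine Nat.Coprime.mul_right hcop ?_
      rw [Nat.coprime_mul_left_add_left]
      exact hbW
    set Xt : ℕ := W * t + b with hXt
    have hXtX : (Xt : ℝ) ≤ X := by
      rw [hXt, hXdef]; exact_mod_cast Nat.add_le_add_right (Nat.mul_le_mul_left W ht) b
    have hXt1 : (1 : ℝ) ≤ Xt := by rw [hXt]; exact_mod_cast (show 1 ≤ W * t + b by omega)
    -- the three comparisons
    have h1 := abs_Pfun_sub_chebyshevPsiMod_le hW hb hb1 hi t
    rw [← hXt] at h1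
    have h1' : |Pfun W b q i t -
        chebyshevPsiMod (q * W) ((W * i + b : ℕ) : ZMod (q * W)) (Xt : ℝ)| ≤
        2 * Real.sqrt X * Real.log X + Real.log W := by
      refine h1.trans (add_le_add ?_ le_rfl)
      exact mul_le_mul (mul_le_mul_of_nonneg_left (Real.sqrt_le_sqrt hXtX) (by norm_num))
        (Real.log_le_log (by linarith) hXtX) (Real.log_nonneg hXt1) (by positivity)
    set a : (ZMod (q * W))ˣ := ZMod.unitOfCoprime (W * i + b) hcopL with ha
    have hacoe : (a : ZMod (q * W)) = ((W * i + b : ℕ) : ZMod (q * W)) :=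
      ZMod.coe_unitOfCoprime _ _
    have h2 : |chebyshevPsiMod (q * W) ((W * i + b : ℕ) : ZMod (q * W)) (Xt : ℝ) -
        (Xt : ℝ) / Nat.totient (q * W)| ≤ 7 * Real.sqrt X + C₂ * 2 ^ A₂ * X / Real.log X ^ A₂ := by
      have := abs_chebyshevPsiMod_sub_le_of_SW hA₂ hC₂ hSW hX9
        (q := q * W) (Nat.mul_pos hq hW) hqW a (Nat.cast_nonneg Xt) hXtX
      rwa [hacoe] at this
    have h3 : |(Nat.totient W : ℝ) / W * ((Xt : ℝ) / Nat.totient (q * W)) -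
        dens W b q i * cnt q i t| ≤ 2 * q + 1 := by
      rw [hdens]
      have hcnt := abs_cnt_sub_div_le_two hq hi t
      have hXt' : (Xt : ℝ) = W * t + b := by rw [hXt]; push_cast; ring
      have hbW' : (b : ℝ) ≤ W := by exact_mod_cast hb.le
      have hφle : (Nat.totient W : ℝ) ≤ Nat.totient (q * W) := totient_le_totient_mul hq hW
      have hr1 : (Nat.totient W : ℝ) / Nat.totient (q * W) ≤ 1 := by rwa [div_le_one hφL0]
      have hr0 : 0 ≤ (Nat.totient W : ℝ) / Nat.totient (q * W) := by positivity
      have hsplit : (Nat.totient W : ℝ) / W * ((Xt : ℝ) / Nat.totient (q * W)) -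
          (q : ℝ) * Nat.totient W / Nat.totient (q * W) * cnt q i t =
          (Nat.totient W : ℝ) / Nat.totient (q * W) * (q * ((t : ℝ) / q - cnt q i t)) +
            (Nat.totient W : ℝ) / W * (b / Nat.totient (q * W)) := by
        rw [hXt']; field_simp; ring
      rw [hsplit]
      refine (abs_add_le _ _).trans (add_le_add ?_ ?_)
      · rw [abs_mul, abs_of_nonneg hr0, abs_mul, abs_of_nonneg hq0.le]
        have : |(t : ℝ) / q - cnt q i t| ≤ 2 := by rwa [abs_sub_comm]
        calc (Nat.totient W : ℝ) / Nat.totient (q * W) * (q * |(t : ℝ) / q - cnt q i t|)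
            ≤ 1 * (q * 2) := by gcongr
          _ = 2 * q := by ring
      · rw [abs_of_nonneg (by positivity)]
        have e : (Nat.totient W : ℝ) / W * (b / Nat.totient (q * W)) =
            (b / W) * ((Nat.totient W : ℝ) / Nat.totient (q * W)) := by ring
        rw [e]
        have hbW1 : (b : ℝ) / W ≤ 1 := by rwa [div_le_one hW0]
        calc (b : ℝ) / W * ((Nat.totient W : ℝ) / Nat.totient (q * W)) ≤ 1 * 1 :=
              mul_le_mul hbW1 hr1 hr0 zero_le_one
          _ = 1 := by ring
    -- combine
    have hdecomp : (Nat.totient W : ℝ) / W * Pfun W b q i t - dens W b q i * cnt q i t =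
        (Nat.totient W : ℝ) / W * (Pfun W b q i t -
          chebyshevPsiMod (q * W) ((W * i + b : ℕ) : ZMod (q * W)) (Xt : ℝ)) +
        (Nat.totient W : ℝ) / W * (chebyshevPsiMod (q * W) ((W * i + b : ℕ) : ZMod (q * W)) (Xt : ℝ) -
          (Xt : ℝ) / Nat.totient (q * W)) +
        ((Nat.totient W : ℝ) / W * ((Xt : ℝ) / Nat.totient (q * W)) - dens W b q i * cnt q i t) := by
      ring
    rw [hdecomp]
    have hlogW : Real.log W ≤ Real.log ((q * W : ℕ) : ℝ) := by
      refine Real.log_le_log hW0 ?_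
      have : W ≤ q * W := Nat.le_mul_of_pos_left W hq
      exact_mod_cast this
    calc |(Nat.totient W : ℝ) / W * (Pfun W b q i t -
            chebyshevPsiMod (q * W) ((W * i + b : ℕ) : ZMod (q * W)) (Xt : ℝ)) +
          (Nat.totient W : ℝ) / W * (chebyshevPsiMod (q * W) ((W * i + b : ℕ) : ZMod (q * W)) (Xt : ℝ) -
            (Xt : ℝ) / Nat.totient (q * W)) +
          ((Nat.totient W : ℝ) / W * ((Xt : ℝ) / Nat.totient (q * W)) - dens W b q i * cnt q i t)|
        ≤ |(Nat.totient W : ℝ) / W * (Pfun W b q i t -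
            chebyshevPsiMod (q * W) ((W * i + b : ℕ) : ZMod (q * W)) (Xt : ℝ))| +
          |(Nat.totient W : ℝ) / W * (chebyshevPsiMod (q * W) ((W * i + b : ℕ) : ZMod (q * W)) (Xt : ℝ) -
            (Xt : ℝ) / Nat.totient (q * W))| +
          |(Nat.totient W : ℝ) / W * ((Xt : ℝ) / Nat.totient (q * W)) - dens W b q i * cnt q i t| :=
          abs_add_three _ _ _
      _ ≤ 1 * (2 * Real.sqrt X * Real.log X + Real.log W) +
          1 * (7 * Real.sqrt X + C₂ * 2 ^ A₂ * X / Real.log X ^ A₂) + (2 * q + 1) := by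
          rw [abs_mul, abs_mul, abs_of_nonneg hρ0]
          exact add_le_add (add_le_add (mul_le_mul hρ h1' (abs_nonneg _) zero_le_one)
            (mul_le_mul hρ h2 (abs_nonneg _) zero_le_one)) h3
      _ ≤ majorErr A₂ C₂ X q W := by
          unfold majorErr
          linarith
  · -- a class not coprime to `q`
    have hdens : dens W b q i = 0 := by simp [dens, hcop]
    rw [hdens, zero_mul, sub_zero, abs_of_nonneg (mul_nonneg hρ0 (Pfun_nonneg _ _ _ _ _))]
    have hP := Pfun_le_log_of_not_coprime hq hW hi hcop t
    have hlogq : Real.log q ≤ Real.log ((q * W : ℕ) : ℝ) := by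
      refine Real.log_le_log hq0 ?_
      have : q ≤ q * W := Nat.le_mul_of_pos_right q hW
      exact_mod_cast this
    calc (Nat.totient W : ℝ) / W * Pfun W b q i t ≤ 1 * Pfun W b q i t :=
          mul_le_mul_of_nonneg_right hρ (Pfun_nonneg _ _ _ _ _)
      _ ≤ Real.log ((q * W : ℕ) : ℝ) := by rw [one_mul]; exact hP.trans hlogq
      _ ≤ majorErr A₂ C₂ X q W := by
          unfold majorErr
          have : (0 : ℝ) ≤ 2 * q + 1 := by positivity
          linarith



/-! ### The major-arc estimate for `∑ (Λ'_{b,W}(n) − 1) e(nα)` -/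

/-- The twisted error sum of the class `i`:
`E_i(β) = ∑_{n ≤ N, n ≡ i (q)} ((φ(W)/W) Λ'(Wn+b) − dens_i) e(nβ)`. [folklore] -/
def errSum (W b q i N : ℕ) (β : ℝ) : ℂ :=
  ∑ n ∈ (Icc 1 N).filter (fun n => n % q = i),
    (((Nat.totient W : ℝ) / W * vonMangoldtPrime (W * n + b) - dens W b q i : ℝ) : ℂ) *
      (𝐞 ((n : ℝ) * β) : ℂ)

/-- **Decomposition along residue classes.** With `ζ^q = 1`-periodic phases `ζ^{n mod q}`,
`∑_{n ≤ N} (Λ'_{b,W}(n) − 1) ζ^{n mod q} e(nβ) = ∑_{i < q} ζ^i (E_i(β) + (dens_i − 1) V_i(β))`.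
[folklore] -/
theorem sum_vonMangoldtW_sub_one_eq {W b q N : ℕ} (hq : 0 < q) (ζ : ℂ) (β : ℝ) :
    ∑ n ∈ Icc 1 N, ((vonMangoldtW W b n - 1 : ℝ) : ℂ) * (ζ ^ (n % q) * (𝐞 ((n : ℝ) * β) : ℂ)) =
      ∑ i ∈ range q, ζ ^ i *
        (errSum W b q i N β + ((dens W b q i - 1 : ℝ) : ℂ) * classExpSum q i N β) := by
  rw [sum_Icc_eq_sum_range_sum_filter hq]
  refine Finset.sum_congr rfl fun i _ => ?_
  rw [errSum, classExpSum, Finset.mul_sum, mul_add, Finset.mul_sum, Finset.mul_sum,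
    ← Finset.sum_add_distrib]
  refine Finset.sum_congr rfl fun n hn => ?_
  have hnq : n % q = i := (Finset.mem_filter.1 hn).2
  rw [hnq, vonMangoldtW]
  push_cast
  ring

/-- **The error classes are small (Siegel–Walfisz + partial summation):**
`‖E_i(β)‖ ≤ Mq (1 + 2π|β|N)`. [folklore] -/
theorem norm_errSum_le {A₂ C₂ : ℝ} (hA₂ : 0 < A₂) (hC₂ : 0 ≤ C₂) (hSW : SWBound A₂ C₂)
    {W b q N : ℕ} (hW : 0 < W) (hb : b < W) (hb1 : 1 ≤ b) (hbW : b.Coprime W) (hq : 0 < q)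
    {i : ℕ} (hi : i < q) (hX9 : (9 : ℝ) ≤ ((W * N + b : ℕ) : ℝ))
    (hqW : ((q * W : ℕ) : ℝ) ≤ (Real.log ((W * N + b : ℕ) : ℝ) / 2) ^ A₂) (β : ℝ) :
    ‖errSum W b q i N β‖ ≤
      majorErr A₂ C₂ ((W * N + b : ℕ) : ℝ) q W * (1 + 2 * Real.pi * |β| * N) := by
  classical
  set ρ : ℝ := (Nat.totient W : ℝ) / W with hρ
  set c : ℕ → ℂ := fun n =>
    if n % q = i then (((ρ * vonMangoldtPrime (W * n + b) - dens W b q i : ℝ) : ℂ)) else 0 with hc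
  have hrepr : errSum W b q i N β = ∑ n ∈ Icc 1 N, c n * (𝐞 ((n : ℝ) * β) : ℂ) := by
    rw [errSum, Finset.sum_filter]
    refine Finset.sum_congr rfl fun n _ => ?_
    simp only [hc]
    split_ifs <;> simp [hρ]
  rw [hrepr]
  have hM : ∀ t ≤ N, ‖∑ k ∈ Icc 1 t, c k‖ ≤ majorErr A₂ C₂ ((W * N + b : ℕ) : ℝ) q W := by
    intro t ht
    have hsum : ∑ k ∈ Icc 1 t, c k = ((ρ * Pfun W b q i t - dens W b q i * cnt q i t : ℝ) : ℂ) := by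
      rw [hc, ← Finset.sum_filter, Pfun, cnt, Finset.mul_sum]
      push_cast
      rw [Finset.sum_sub_distrib, Finset.sum_const, nsmul_eq_mul, mul_comm (_ : ℂ) ((dens W b q i : ℝ) : ℂ)]
    rw [hsum, Complex.norm_real, Real.norm_eq_abs]
    exact abs_partialSum_le hA₂ hC₂ hSW hW hb hb1 hbW hq hi hX9 hqW ht
  have hf : ∀ n : ℕ, ‖(𝐞 ((n : ℝ) * β) : ℂ)‖ ≤ 1 := fun n => (Circle.norm_coe _).le
  have hδ : ∀ n : ℕ, ‖(𝐞 (((n + 1 : ℕ) : ℝ) * β) : ℂ) - 𝐞 ((n : ℝ) * β)‖ ≤ 2 * Real.pi * |β| := by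
    intro n
    refine (norm_fourierChar_sub_fourierChar_le _ _).trans ?_
    rw [show ((n + 1 : ℕ) : ℝ) * β - (n : ℝ) * β = β by push_cast; ring]
  have := norm_sum_Icc_mul_le c (fun n => (𝐞 ((n : ℝ) * β) : ℂ)) N hM hf hδ
  simpa [mul_comm, mul_left_comm, mul_assoc] using this

/-- **The main term on a major arc.** For `ζ` a primitive `q`-th root of unity,
`‖∑_{i<q} ζ^i (dens_i − 1) V_i(β)‖ ≤ [q > 1, (q,W)=1] (N + 2q)/φ(q) + q² (1 + 2π|β|N)`:
for `q = 1` the sum vanishes (`dens_0 = 1`); for `q > 1` write `V_i = V_0 + (V_i − V_0)`, use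
`∑_i ζ^i = 0`, the Ramanujan-type sums `∑_{(Wi+b,q)=1} ζ^i` (`= 0` if `(q,W) > 1`, of modulus
`≤ 1` if `(q,W) = 1`, in which case `dens = q/φ(q)` on the coprime classes), `‖V_0‖ ≤ N/q + 2`
and `‖V_i − V_0‖ ≤ 1 + 2π|β|N`. [folklore] -/
theorem norm_mainTerm_le {W b q N : ℕ} (hW : 0 < W) (hq : 0 < q) {ζ : ℂ}
    (hζ : IsPrimitiveRoot ζ q) (β : ℝ) :
    ‖∑ i ∈ range q, ζ ^ i * (((dens W b q i - 1 : ℝ) : ℂ) * classExpSum q i N β)‖ ≤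
      (if 1 < q ∧ q.Coprime W then ((N : ℝ) + 2 * q) / Nat.totient q else 0) +
        (q : ℝ) ^ 2 * (1 + 2 * Real.pi * |β| * N) := by
  classical
  have hq0 : (0 : ℝ) < q := by exact_mod_cast hq
  have hK : 0 ≤ 1 + 2 * Real.pi * |β| * N := by positivity
  rcases eq_or_lt_of_le (Nat.one_le_iff_ne_zero.2 hq.ne') with h1 | h1
  · -- `q = 1`: the sum vanishes
    subst h1
    have hd : dens W b 1 0 = 1 := by
      have hφ : (Nat.totient W : ℝ) ≠ 0 := by exact_mod_cast (Nat.totient_pos.2 hW).ne'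
      simp [dens, hφ]
    simpa [hd] using hK
  -- `q > 1`
  have hif : ¬ (1 < 1) := lt_irrefl 1
  set x : ℕ → ℂ := fun i => ζ ^ i * ((dens W b q i - 1 : ℝ) : ℂ) with hx
  set V : ℕ → ℂ := fun i => classExpSum q i N β with hV
  have hrw : ∑ i ∈ range q, ζ ^ i * (((dens W b q i - 1 : ℝ) : ℂ) * classExpSum q i N β) =
      (∑ i ∈ range q, x i) * V 0 + ∑ i ∈ range q, x i * (V i - V 0) := by
    rw [Finset.sum_mul, ← Finset.sum_add_distrib]
    refine Finset.sum_congr rfl fun i _ => ?_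
    simp only [hx, hV]; ring
  rw [hrw]
  refine (norm_add_le _ _).trans (add_le_add ?_ ?_)
  · -- the coefficient sum `∑ ζ^i (dens_i − 1) = λ ∑_{coprime} ζ^i − ∑ ζ^i`
    set lam : ℝ := (q : ℝ) * (Nat.totient W : ℝ) / (Nat.totient (q * W) : ℝ) with hlam
    have hcoef : ∑ i ∈ range q, x i =
        (lam : ℂ) * ∑ i ∈ (range q).filter (fun i => (W * i + b).Coprime q), ζ ^ i := by
      have h1' : ∑ i ∈ range q, x i =
          ∑ i ∈ range q, ζ ^ i * ((dens W b q i : ℝ) : ℂ) - ∑ i ∈ range q, ζ ^ i := by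
        rw [← Finset.sum_sub_distrib]
        refine Finset.sum_congr rfl fun i _ => ?_
        simp only [hx]; push_cast; ring
      rw [h1', hζ.geom_sum_eq_zero h1, sub_zero, Finset.mul_sum, Finset.sum_filter]
      refine Finset.sum_congr rfl fun i _ => ?_
      unfold dens
      split_ifs <;> simp [hlam]; ring
    rw [norm_mul, hcoef, norm_mul, Complex.norm_real, Real.norm_eq_abs]
    have hlam0 : 0 ≤ lam := by rw [hlam]; positivity
    rw [abs_of_nonneg hlam0]
    by_cases hcop : q.Coprime W
    · rw [if_pos ⟨h1, hcop⟩]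
      have hS := norm_sum_pow_filter_coprime_le_one (b := b) hq hζ hcop
      have hV0 := norm_classExpSum_le hq hq N β
      have hlam' : lam = q / Nat.totient q := by
        rw [hlam, Nat.totient_mul hcop]
        have hφ : (Nat.totient W : ℝ) ≠ 0 := by exact_mod_cast (Nat.totient_pos.2 hW).ne'
        push_cast
        field_simp
      have hφq : (0 : ℝ) < Nat.totient q := by exact_mod_cast Nat.totient_pos.2 hq
      rw [hlam']
      calc (q : ℝ) / Nat.totient q *
            ‖∑ i ∈ (range q).filter (fun i => (W * i + b).Coprime q), ζ ^ i‖ * ‖V 0‖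
          ≤ (q : ℝ) / Nat.totient q * 1 * ((N : ℝ) / q + 2) := by gcongr
        _ = ((N : ℝ) + 2 * q) / Nat.totient q := by field_simp
    · rw [if_neg (fun h => hcop h.2)]
      obtain ⟨p, hp, hpq, hpW⟩ := Nat.Prime.not_coprime_iff_dvd.1 hcop
      rw [sum_pow_filter_coprime_eq_zero (b := b) hq hζ hp hpq hpW, norm_zero, mul_zero, zero_mul]
  · -- the variation of `V_i`
    calc ‖∑ i ∈ range q, x i * (V i - V 0)‖ ≤ ∑ i ∈ range q, ‖x i * (V i - V 0)‖ := norm_sum_le _ _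
      _ ≤ ∑ i ∈ range q, (q : ℝ) * (1 + 2 * Real.pi * |β| * N) := by
          refine Finset.sum_le_sum fun i hi => ?_
          rw [Finset.mem_range] at hi
          rw [norm_mul, hx, norm_mul, norm_pow, hζ.norm'_eq_one hq.ne', one_pow, one_mul,
            Complex.norm_real, Real.norm_eq_abs]
          exact mul_le_mul (abs_dens_sub_one_le hq hW) (norm_classExpSum_sub_le hq hi N β)
            (norm_nonneg _) hq0.le
      _ = (q : ℝ) ^ 2 * (1 + 2 * Real.pi * |β| * N) := by
          rw [Finset.sum_const, Finset.card_range, nsmul_eq_mul]; ring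

/-- **The major-arc estimate for the `W`-tricked von Mangoldt function** (the `s = 1` content of
Green–Tao 2010, Prop. 10.2/§12 for the circle, via Siegel–Walfisz as in Nathanson, GTM 164,
Lemmas 8.2–8.3). Let `1 ≤ b < W`, `(b, W) = 1`, `q ≥ 1`, `(a, q) = 1`, `X = W N + b ≥ 9`,
`qW ≤ (log X/2)^{A₂}` and assume the Siegel–Walfisz bound `SWBound A₂ C₂`. Then for every real `β`
`‖∑_{n ≤ N} (Λ'_{b,W}(n) − 1) e(n(a/q + β))‖ ≤ q Mq (1 + 2π|β|N) + [q > 1, (q, W) = 1] (N + 2q)/φ(q) + q² (1 + 2π|β|N)`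
with `Mq = majorErr A₂ C₂ X q W = 7√X + C₂ 2^{A₂} X/log^{A₂} X + 2√X log X + log(qW) + 2q + 1`.
(The `W`-trick shows in the middle term: moduli `q > 1` sharing a prime with `W` carry no main
term, and for `(q, W) = 1`, `q > 1` one has `φ(q) ≥ w` when `W = ∏_{p ≤ w} p`.)
[cite: GreenTao2010, §12 (the case `s = 1`); Nathanson1996, Lemmas 8.2–8.3] -/
theorem norm_sum_vonMangoldtW_sub_one_majorArc_le {A₂ C₂ : ℝ} (hA₂ : 0 < A₂) (hC₂ : 0 ≤ C₂)
    (hSW : SWBound A₂ C₂) {W b q N : ℕ} (hW : 0 < W) (hb : b < W) (hb1 : 1 ≤ b)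
    (hbW : b.Coprime W) (hq : 0 < q) {a : ℤ} (ha : IsCoprime a (q : ℤ))
    (hX9 : (9 : ℝ) ≤ ((W * N + b : ℕ) : ℝ))
    (hqW : ((q * W : ℕ) : ℝ) ≤ (Real.log ((W * N + b : ℕ) : ℝ) / 2) ^ A₂) (β : ℝ) :
    ‖∑ n ∈ Icc 1 N, ((vonMangoldtW W b n - 1 : ℝ) : ℂ) * (𝐞 ((n : ℝ) * ((a : ℝ) / q + β)) : ℂ)‖ ≤
      q * majorErr A₂ C₂ ((W * N + b : ℕ) : ℝ) q W * (1 + 2 * Real.pi * |β| * N) +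
        (if 1 < q ∧ q.Coprime W then ((N : ℝ) + 2 * q) / Nat.totient q else 0) +
        (q : ℝ) ^ 2 * (1 + 2 * Real.pi * |β| * N) := by
  classical
  -- `ζ = e(a/q)` is a primitive `q`-th root of unity
  set ζ : ℂ := (𝐞 ((a : ℝ) / q) : ℂ) with hζdef
  have hζ : IsPrimitiveRoot ζ q := by
    have := Complex.isPrimitiveRoot_exp_of_isCoprime a q hq.ne' ha
    convert this using 1
    rw [hζdef, Real.fourierChar_apply]
    congr 1; push_cast; ring
  have hζq : ζ ^ q = 1 := hζ.pow_eq_one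
  have hterm : ∀ n : ℕ, (𝐞 ((n : ℝ) * ((a : ℝ) / q + β)) : ℂ) = ζ ^ (n % q) * 𝐞 ((n : ℝ) * β) := by
    intro n
    rw [mul_add, AddChar.map_add_eq_mul, Circle.coe_mul, fourierChar_natCast_mul, ← hζdef,
      pow_mod_eq hζq]
  have hS : ∑ n ∈ Icc 1 N, ((vonMangoldtW W b n - 1 : ℝ) : ℂ) * (𝐞 ((n : ℝ) * ((a : ℝ) / q + β)) : ℂ)
      = ∑ i ∈ range q, ζ ^ i * errSum W b q i N β +
        ∑ i ∈ range q, ζ ^ i * (((dens W b q i - 1 : ℝ) : ℂ) * classExpSum q i N β) := by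
    rw [← Finset.sum_add_distrib]
    simp_rw [hterm, ← mul_add]
    exact sum_vonMangoldtW_sub_one_eq hq ζ β
  rw [hS, add_assoc]
  refine (norm_add_le _ _).trans (add_le_add ?_ (norm_mainTerm_le hW hq hζ β))
  calc ‖∑ i ∈ range q, ζ ^ i * errSum W b q i N β‖
      ≤ ∑ i ∈ range q, ‖ζ ^ i * errSum W b q i N β‖ := norm_sum_le _ _
    _ ≤ ∑ i ∈ range q, majorErr A₂ C₂ ((W * N + b : ℕ) : ℝ) q W * (1 + 2 * Real.pi * |β| * N) := by
        refine Finset.sum_le_sum fun i hi => ?_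
        rw [Finset.mem_range] at hi
        rw [norm_mul, norm_pow, hζ.norm'_eq_one hq.ne', one_pow, one_mul]
        exact norm_errSum_le hA₂ hC₂ hSW hW hb hb1 hbW hq hi hX9 hqW β
    _ = q * majorErr A₂ C₂ ((W * N + b : ℕ) : ℝ) q W * (1 + 2 * Real.pi * |β| * N) := by
        rw [Finset.sum_const, Finset.card_range, nsmul_eq_mul]; ring

end WTrick

end Literature.NumberTheory.Sieve
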